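import Literature.MathematicalPhysics.QuantumFieldTheory.BalabanImbrieJaffe1984to88.BIJ88ObservableGas312

/-!
# `BalabanImbrieJaffe1984to88.BIJ88ClusterSupports312` — T. Bałaban, J. Imbrie, A. Jaffe, *Effective action and cluster properties of
the abelian Higgs model*, Commun. Math. Phys. **114** (1988) 257–315 [BalabanImbrieJaffe1988]: Sect. 5.14, p. 312 [PDF 56] — step 2 of the
derivation of the second display of p. 312: the cluster terms dressing a decorated family are LOCALIZED BY THEIR SUPPORTS (sets of cubes) and
the exponential of the support-indexed terms is Mayer-expanded over finitely many supports.

HONEST FRAMING (cell `lit-balaban`, verbatim): statement-level skeleton of published theorems with citation tags; proofs where landed; nothing here is a claim about the Yang–Mills mass gap.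

PDF held: `paper:balaban1988-cmp114-bij-abelian-higgs-effective-action` (journal page = PDF page + 256); p. 309/310 = PDF p. 53/54, p. 312 = PDF p. 56.

CITATION HEADER (verbatim).  p. 312 [PDF 56]: *"We use essentially the same expansion as before, Mayer-expanding V^{(k)}(Y)'s and interpolating the
Gaussian measure. Finally the polymer expansion u = 1 + a permits us to factor out the normalization. Without going into details, it is clear
that the result can be written in the following form: ⟨Π_{σ₁} F^{m̄}_{k,loc}(X_{σ₁})⟩₁ = Σ_{{X_{r′}}} Π_{r′} G_k(X_{r′}) Π_{c: X_c⊄∪_{r′}X_{r′}}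
F^L_{k+1,loc}(X_c). The X_{r′} are disjoint, and each one covers at least one X_{σ₁}"*.  p. 310 [PDF 54] (the *"same expansion"*, for the
t-derivatives): *"Here ℒ denotes pairs of clusters (lines) and G runs over graphs of such lines in which each Y_δ is connected directly or
indirectly to some X_γ. … Here W₆^{(k)′}(X) is obtained by summing only over {X_γ}, (Y₁,…,Y_B) which fill X"* — the terms are regrouped
BY THE SET OF CUBES THEY FILL.

WHAT IS REPRODUCED (unit `lit-balaban-p25`, generation 11 of the Phase-2 proof seat p25; SKELETON row `C2.Claim@312` (second display) — step 2,
on top of `BIJ88ObservableGas312` (step 1); HOME `run/shared/lean/pub/lit-balaban/lit-balaban-p25/`).  Geometry enters: cubes `ι`, every vacuum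
polymer `Y : P` has a support `supp Y : Finset ι` and every decorated polymer `X : Q` a support `suppQ X`; the printed incompatibility *"X, Y
overlap"* is support overlap (bridging hypothesis `hincQ : incQ X Y ↔ ¬ Disjoint (suppQ X) (supp Y)`).
§1 `csupp` (support of a family of vacuum polymers = the set of cubes it fills), `dsupp` (support of a decorated family), `exists_incQ_iff`
  (a cluster overlaps `D` iff its support meets `dsupp D`), `supports Λ` (the finitely many supports of subfamilies of `Λ`).
§2 `suppWeight` `Ψ(S) := Σ_{C ⊆ Λ, csupp C = S} Φ^T(C)` (the cluster terms FILLING `S`, p. 310 *"summing only over … which fill X"*),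
  `sum_clusters_eq_sum_supports` (Σ_{C overlapping D} Φ^T(C) = Σ_{S ∈ supports Λ, S meets dsupp D} Ψ(S)).
§3 `mayer` `m(S) := e^{−Ψ(S)} − 1`, `exp_neg_sum_eq_sum_prod_mayer` (the finite Mayer expansion `exp(−Σ_{S∈𝒮′} Ψ(S)) = Σ_{𝒴 ⊆ 𝒮′} Π_{S∈𝒴} m(S)`,
  Mathlib `Finset.prod_one_add`), and the result of step 2 **`obsRatio_eq_sum_sum`**: in a Kotecký–Preiss volume
  `obsNumerator / Z(Λ) = Σ_{D ∈ 𝒟} Σ_{𝒴 ⊆ supports Λ, every S ∈ 𝒴 meeting dsupp D} Π_{X∈D} wQ X · Π_{S∈𝒴} m(S)` — the normalized expectation as a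
  finite sum over decorated families dressed by finitely many support sets, each overlapping the family (p. 310: *"each Y_δ is connected
  directly or indirectly to some X_γ"*; the indirect connections are inside the clusters).
HONEST SCOPE: finite identities given the KP hypothesis on the vacuum gas; no bound on `Ψ`, `m` or `G_k` is asserted; 0 `sorry`, 0 new `Prop` facts.
-/

noncomputable section

open Finset
open Literature.Probability.LatticeModels
open Literature.MathematicalPhysics.QuantumFieldTheory.BalabanImbrieJaffe1984to88.BIJ88ObservableGas312

namespace Literature.MathematicalPhysics.QuantumFieldTheory.BalabanImbrieJaffe1984to88.BIJ88ClusterSupports312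

variable {ι : Type*} [DecidableEq ι] {P : Type*} [DecidableEq P] {Q : Type*}
variable (supp : P → Finset ι) (suppQ : Q → Finset ι)

/-! ## §1 Supports -/

/-- the SUPPORT of a family `C` of vacuum polymers (a cluster): the set of cubes it fills, `∪_{Y∈C} supp Y` (p. 310 [PDF 54] *"{X_γ}, (Y₁,…,Y_B)
which fill X"*). [cite: BalabanImbrieJaffe1988, (5.14.5) p.312] -/
def csupp (C : Finset P) : Finset ι := C.biUnion supp

/-- the support of a decorated family `D`: `∪_{X∈D} suppQ X` (the cubes of the `X_γ`). [cite: BalabanImbrieJaffe1988, (5.14.5) p.312] -/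
def dsupp (D : Finset Q) : Finset ι := D.biUnion suppQ

/-- the finitely many supports of subfamilies of the volume `Λ`. [cite: BalabanImbrieJaffe1988, (5.14.5) p.312] -/
def supports (Λ : Finset P) : Finset (Finset ι) := Λ.powerset.image (csupp supp)

variable {supp suppQ}

omit [DecidableEq P] in
/-- membership in `csupp`. [cite: BalabanImbrieJaffe1988, (5.14.5) p.312] -/
theorem mem_csupp {C : Finset P} {i : ι} : i ∈ csupp supp C ↔ ∃ Y ∈ C, i ∈ supp Y := mem_biUnion

/-- membership in `dsupp`. [cite: BalabanImbrieJaffe1988, (5.14.5) p.312] -/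
theorem mem_dsupp {D : Finset Q} {i : ι} : i ∈ dsupp suppQ D ↔ ∃ X ∈ D, i ∈ suppQ X := mem_biUnion

omit [DecidableEq P] in
/-- `supp Y ⊆ csupp C` for `Y ∈ C`. [cite: BalabanImbrieJaffe1988, (5.14.5) p.312] -/
theorem supp_subset_csupp {C : Finset P} {Y : P} (hY : Y ∈ C) : supp Y ⊆ csupp supp C := subset_biUnion_of_mem supp hY

/-- `suppQ X ⊆ dsupp D` for `X ∈ D`. [cite: BalabanImbrieJaffe1988, (5.14.5) p.312] -/
theorem suppQ_subset_dsupp {D : Finset Q} {X : Q} (hX : X ∈ D) : suppQ X ⊆ dsupp suppQ D := subset_biUnion_of_mem suppQ hX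

omit [DecidableEq P] in
/-- the support of a subfamily of `Λ` is one of the `supports Λ`. [cite: BalabanImbrieJaffe1988, (5.14.5) p.312] -/
theorem csupp_mem_supports {Λ C : Finset P} (hC : C ⊆ Λ) : csupp supp C ∈ supports supp Λ :=
  mem_image.2 ⟨C, mem_powerset.2 hC, rfl⟩

omit [DecidableEq P] in
/-- members of `supports Λ` lie inside the support of `Λ`. [cite: BalabanImbrieJaffe1988, (5.14.5) p.312] -/
theorem subset_csupp_of_mem_supports {Λ : Finset P} {S : Finset ι} (hS : S ∈ supports supp Λ) : S ⊆ csupp supp Λ := by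
  obtain ⟨C, hC, rfl⟩ := mem_image.1 hS
  exact biUnion_subset_biUnion_of_subset_left supp (mem_powerset.1 hC)

omit [DecidableEq P] in
/-- two supports meet iff some member of the one overlaps some member of the other. [cite: BalabanImbrieJaffe1988, (5.14.5) p.312] -/
theorem not_disjoint_csupp_dsupp_iff {C : Finset P} {D : Finset Q} :
    ¬ Disjoint (csupp supp C) (dsupp suppQ D) ↔ ∃ Y ∈ C, ∃ X ∈ D, ¬ Disjoint (suppQ X) (supp Y) := by
  rw [csupp, dsupp, disjoint_biUnion_left]
  push Not
  refine exists_congr fun Y => and_congr_right fun _ => ?_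
  rw [disjoint_biUnion_right]
  push Not
  refine exists_congr fun X => and_congr_right fun _ => ?_
  rw [disjoint_comm]

omit [DecidableEq P] in
/-- with the printed incompatibility *"X, Y overlap"* (bridging hypothesis `hincQ`): a family of vacuum polymers `C` overlaps the decorated
family `D` iff its support meets `dsupp D`. [cite: BalabanImbrieJaffe1988, (5.14.5) p.312] -/
theorem exists_incQ_iff {incQ : Q → P → Prop} (hincQ : ∀ X Y, incQ X Y ↔ ¬ Disjoint (suppQ X) (supp Y)) {C : Finset P} {D : Finset Q} :
    (∃ Y ∈ C, ∃ X ∈ D, incQ X Y) ↔ ¬ Disjoint (csupp supp C) (dsupp suppQ D) := by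
  rw [not_disjoint_csupp_dsupp_iff]
  simp only [hincQ]

/-! ## §2 The cluster terms grouped by support -/

variable (supp) in
/-- **`Ψ(S)`**: the truncated functionals of the families of vacuum polymers of `Λ` whose support is exactly `S` — the cluster terms FILLING the
set of cubes `S` (p. 310 [PDF 54]: *"obtained by summing only over {X_γ}, (Y₁,…,Y_B) which fill X"*). [cite: BalabanImbrieJaffe1988, (5.14.5) p.312] -/
def suppWeight (inc : P → P → Prop) [DecidableRel inc] (w : P → ℂ) (Λ : Finset P) (S : Finset ι) : ℂ :=
  ∑ C ∈ Λ.powerset with csupp supp C = S, truncatedWeight inc w C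

/-- **grouping the clusters by their supports**: for any set of cubes `T`,
`Σ_{C ⊆ Λ, csupp C meets T} Φ^T(C) = Σ_{S ∈ supports Λ, S meets T} Ψ(S)`. [cite: BalabanImbrieJaffe1988, (5.14.5) p.312] -/
theorem sum_filter_csupp_eq_sum_supports (inc : P → P → Prop) [DecidableRel inc] (w : P → ℂ) (Λ : Finset P)
    (p : Finset ι → Prop) [DecidablePred p] :
    ∑ C ∈ Λ.powerset with p (csupp supp C), truncatedWeight inc w C =
      ∑ S ∈ supports supp Λ with p S, suppWeight supp inc w Λ S := by
  rw [← sum_fiberwise_of_maps_to (s := Λ.powerset.filter fun C => p (csupp supp C)) (t := (supports supp Λ).filter p)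
    (g := csupp supp) (fun C hC => mem_filter.2 ⟨csupp_mem_supports (mem_powerset.1 (mem_filter.1 hC).1), (mem_filter.1 hC).2⟩)]
  refine sum_congr rfl fun S hS => ?_
  rw [suppWeight, filter_filter]
  refine sum_congr (filter_congr fun C _ => ?_) fun _ _ => rfl
  constructor
  · exact fun h => h.2
  · intro h
    exact ⟨h ▸ (mem_filter.1 hS).2, h⟩

/-- in particular for the clusters dressing a decorated family: `Σ_{C ⊆ Λ overlapping D} Φ^T(C) = Σ_{S ∈ supports Λ, S meets dsupp D} Ψ(S)`.
[cite: BalabanImbrieJaffe1988, (5.14.5) p.312] -/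
theorem sum_clusters_eq_sum_supports {incQ : Q → P → Prop} [∀ X Y, Decidable (incQ X Y)]
    (hincQ : ∀ X Y, incQ X Y ↔ ¬ Disjoint (suppQ X) (supp Y)) (inc : P → P → Prop) [DecidableRel inc] (w : P → ℂ) (Λ : Finset P)
    (D : Finset Q) :
    ∑ C ∈ Λ.powerset with (∃ Y ∈ C, ∃ X ∈ D, incQ X Y), truncatedWeight inc w C =
      ∑ S ∈ supports supp Λ with ¬ Disjoint S (dsupp suppQ D), suppWeight supp inc w Λ S := by
  rw [← sum_filter_csupp_eq_sum_supports inc w Λ (fun S => ¬ Disjoint S (dsupp suppQ D))]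
  exact sum_congr (filter_congr fun C _ => exists_incQ_iff hincQ) fun _ _ => rfl

omit [DecidableEq ι] [DecidableEq P] in
/-- a support meeting something is nonempty (so the empty support `csupp ∅ = ∅` never enters). [cite: BalabanImbrieJaffe1988, (5.14.5) p.312] -/
theorem nonempty_of_not_disjoint {S T : Finset ι} (h : ¬ Disjoint S T) : S.Nonempty := by
  rw [not_disjoint_iff] at h
  obtain ⟨i, hi, -⟩ := h
  exact ⟨i, hi⟩

/-! ## §3 The finite Mayer expansion in the supports and the result of step 2 -/

variable (supp) in
/-- the **Mayer factor** of a support, `m(S) := e^{−Ψ(S)} − 1` (p. 310 [PDF 54] *"We put u = 1 + a and expand in the usual manner"*, here for the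
exponentiated cluster terms). [cite: BalabanImbrieJaffe1988, (5.14.5) p.312] -/
def mayer (inc : P → P → Prop) [DecidableRel inc] (w : P → ℂ) (Λ : Finset P) (S : Finset ι) : ℂ :=
  Complex.exp (-suppWeight supp inc w Λ S) - 1

/-- **the finite Mayer expansion**: `exp(−Σ_{S∈𝒮′} Ψ(S)) = Π_{S∈𝒮′} (1 + m(S)) = Σ_{𝒴 ⊆ 𝒮′} Π_{S∈𝒴} m(S)` (Mathlib `Finset.prod_one_add`).
[cite: BalabanImbrieJaffe1988, (5.14.5) p.312] -/
theorem exp_neg_sum_eq_sum_prod_mayer (inc : P → P → Prop) [DecidableRel inc] (w : P → ℂ) (Λ : Finset P) (𝒮' : Finset (Finset ι)) :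
    Complex.exp (-∑ S ∈ 𝒮', suppWeight supp inc w Λ S) = ∑ 𝒴 ∈ 𝒮'.powerset, ∏ S ∈ 𝒴, mayer supp inc w Λ S := by
  rw [← sum_neg_distrib, Complex.exp_sum, ← prod_one_add]
  exact prod_congr rfl fun S _ => by rw [mayer, add_sub_cancel]

/-- the subfamilies of a filtered family are the subfamilies all of whose members pass the filter. [folklore] -/
private theorem powerset_filter_eq {α : Type*} [DecidableEq α] (s : Finset α) (p : α → Prop) [DecidablePred p] :
    (s.filter p).powerset = s.powerset.filter fun t => ∀ x ∈ t, p x := by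
  ext t
  simp only [mem_powerset, mem_filter, subset_iff]
  exact ⟨fun h => ⟨fun x hx => (h hx).1, fun x hx => (h hx).2⟩, fun h x hx => ⟨h.1 hx, h.2 x hx⟩⟩

/-- **Result of step 2** (p. 312 second display, in progress): in a Kotecký–Preiss volume, with the printed incompatibility *"X, Y overlap"*, the
normalized expectation with the observables inserted is the finite sum
`obsNumerator / Z(Λ) = Σ_{D ∈ 𝒟} Σ_{𝒴 ⊆ supports Λ, every S ∈ 𝒴 meets dsupp D} Π_{X∈D} wQ X · Π_{S∈𝒴} m(S)` — each decorated family dressed by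
finitely many SETS OF CUBES, each of which overlaps it (p. 310: *"graphs … in which each Y_δ is connected directly or indirectly to some X_γ"*;
the indirect connections are summed inside `Ψ`). [cite: BalabanImbrieJaffe1988, (5.14.5) p.312] -/
theorem obsRatio_eq_sum_sum {inc : P → P → Prop} [DecidableRel inc] [Std.Refl inc] [Std.Symm inc] {incQ : Q → P → Prop}
    [∀ X Y, Decidable (incQ X Y)] (hincQ : ∀ X Y, incQ X Y ↔ ¬ Disjoint (suppQ X) (supp Y)) (𝒟 : Finset (Finset Q)) (wQ : Q → ℂ)
    {w : P → ℂ} {a : P → ℝ} {Λ : Finset P} (hKP : IsKPVolume inc w a Λ) :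
    obsNumerator inc incQ 𝒟 wQ w Λ / polymerPartitionFunction inc w Λ =
      ∑ D ∈ 𝒟, ∑ 𝒴 ∈ (supports supp Λ).powerset with (∀ S ∈ 𝒴, ¬ Disjoint S (dsupp suppQ D)),
        (∏ X ∈ D, wQ X) * ∏ S ∈ 𝒴, mayer supp inc w Λ S := by
  rw [obsRatio_eq_sum_mul_exp 𝒟 wQ hKP]
  refine sum_congr rfl fun D _ => ?_
  rw [sum_clusters_eq_sum_supports hincQ inc w Λ D, exp_neg_sum_eq_sum_prod_mayer, powerset_filter_eq, mul_sum]

/-- the same, written as ONE finite sum over the pairs `(D, 𝒴)`. [cite: BalabanImbrieJaffe1988, (5.14.5) p.312] -/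
theorem obsRatio_eq_sum_pairs {inc : P → P → Prop} [DecidableRel inc] [Std.Refl inc] [Std.Symm inc] {incQ : Q → P → Prop}
    [∀ X Y, Decidable (incQ X Y)] (hincQ : ∀ X Y, incQ X Y ↔ ¬ Disjoint (suppQ X) (supp Y)) (𝒟 : Finset (Finset Q)) (wQ : Q → ℂ)
    {w : P → ℂ} {a : P → ℝ} {Λ : Finset P} (hKP : IsKPVolume inc w a Λ) :
    obsNumerator inc incQ 𝒟 wQ w Λ / polymerPartitionFunction inc w Λ =
      ∑ p ∈ (𝒟 ×ˢ (supports supp Λ).powerset) with (∀ S ∈ p.2, ¬ Disjoint S (dsupp suppQ p.1)),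
        (∏ X ∈ p.1, wQ X) * ∏ S ∈ p.2, mayer supp inc w Λ S := by
  rw [obsRatio_eq_sum_sum hincQ 𝒟 wQ hKP, sum_filter, sum_product]
  refine sum_congr rfl fun D _ => ?_
  rw [sum_filter]

omit [DecidableEq P] in
/-- every support entering step 2 is nonempty and lies inside the cubes of `Λ`. [cite: BalabanImbrieJaffe1988, (5.14.5) p.312] -/
theorem mem_supports_props {Λ : Finset P} {D : Finset Q} {𝒴 : Finset (Finset ι)}
    (h𝒴 : 𝒴 ∈ (supports supp Λ).powerset.filter fun 𝒴 => ∀ S ∈ 𝒴, ¬ Disjoint S (dsupp suppQ D)) {S : Finset ι} (hS : S ∈ 𝒴) :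
    S.Nonempty ∧ S ⊆ csupp supp Λ := by
  obtain ⟨h𝒴Λ, hmeet⟩ := mem_filter.1 h𝒴
  exact ⟨nonempty_of_not_disjoint (hmeet S hS), subset_csupp_of_mem_supports (mem_powerset.1 h𝒴Λ hS)⟩

end Literature.MathematicalPhysics.QuantumFieldTheory.BalabanImbrieJaffe1984to88.BIJ88ClusterSupports312
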